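import Mathlib.NumberTheory.Padics.PadicVal.Basic
import Mathlib.Topology.Instances.AddCircle.Defs
import Mathlib.Algebra.Polynomial.RingDivision
import Mathlib.FieldTheory.IsAlgClosed.Basic
import HarnessLib

/-!
# Kottwitz 1992, §18: the image of the map `(A, λ, i) ↦ (γ₀; γ, δ)` (typed skeleton)

R. E. Kottwitz, *Points on some Shimura varieties over finite fields*, J. Amer. Math. Soc. 5 (1992) 373–444
[Kottwitz1992], §18 «Image of the map `(A, λ, i) ↦ (γ₀; γ, δ)`», pp. 436–440 (held text `paper:doi-10-2307-2152772`,
pdf p00NN = printed p. 372+NN; quotations below are AS PRINTED, read on p0064–p0068).  Carpet file of squad TK (cell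
`pub/hodgecm-mathlib`, seat TK-t08): STATEMENTS ONLY — no proof, no `sorry`, no axiom, no instance, no notation.

WHAT IS TYPED.  (a) The local obstruction element of `ℚ/ℤ` attached to a root `a` of a monic `f ∈ F[T]` and a place `v`
of `F[a]` (display on p. 437) — DEFINITIONS with body (`realObstruction`, `padicObstruction`, `otherObstruction`), and the multiplicity condition «`m(a)` is
divisible by `d` and `m(a)/d` kills that element for every `v`» (`MultiplicityCondition`); (b) the characteristic-polynomial
criterion «`f` comes from some `A` in `𝒱_{r,c,B}` iff every root is a `c`-number and every multiplicity satisfies (a)»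
(p. 437, from Lemma 10.13 + Lemmas 3.5∕Cor. 3.4 + Lemmas 11.5∕11.6) as a predicate `CharPolyDatum.Criterion`; (c) **Lemma 18.1**
(pp. 437–438) as a predicate `TripleImageDatum.Lemma18_1`; (d) the linear-algebra fact used in the proof for a real place in
Case C, «the multiplicities of `1` and `−1` as eigenvalues of any element of `Sp_{2n}(ℂ)` are both even» (p. 439), is NOT
restated: it is the tree's `Literature.LinearAlgebra.Matrix.SymplecticCharpoly.even_rootMultiplicity_one_of_mem` ∕
`even_rootMultiplicity_neg_one_of_mem` (cited in section (d) below).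
(b) and (c) are TYPED SKELETONS in the sense of `Literature/AlgebraicGeometry/Liu2021/AlbaneseUnitaryShimura.lean`:
predicates `def P (D : …Datum) : Prop` over a hypothesis structure of BARE CARRIERS naming exactly the objects the printed
statement quantifies over; NOTHING IS ASSERTED (a consumer takes `(h : D.P)` for its own datum).  The objects themselves
(virtual `B`-abelian varieties over `k_r` up to isogeny, §10; the triples `(γ₀; γ, δ)` and the invariant `α(γ₀; γ, δ)`, §14 and
[K5] §2; lattices in `V ⊗ L_r`) are the business of the sibling carpets `VirtualAbelianVarieties.lean` (§10),
`KottwitzTriples.lean` (§14), `AlphaVanishing.lean` (§15) of this directory; here they are carriers.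

THE PRINT (p. 437, p0065 L18–L42): «Now let `f ∈ F[T]` be monic of degree `m`. From our work in §10 we see that `f` comes from
some `A` in `𝒱_{r,c,B}` if and only if every root `a` of `f` in `ℚ̄` is a `c`-number and the multiplicity `m(a)` of each root
`a` of `f` is divisible by its multiplicity in the characteristic polynomial `f_a` of the simple virtual `B`-abelian variety `A_a`
corresponding to `a`. Define a positive integer `d` by the condition `d² = dim_F B`. […] Applying Lemma 10.13, we see that `f`
comes from some `A` in `𝒱_{r,c,B}` if and only if every root `a` of `f` in `ℚ̄` is a `c`-number and the multiplicity `m(a)` of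
each root `a` of `f` has the property that it is divisible by `d` and for every place `v` of `F[a]` the element
`{ ½ − inv_v(B ⊗_F F[a])` if `v` is real; `[F[a]_v : ℚ_p] v(a)/v(p^r) − inv_v(B ⊗_F F[a])` if `v` divides `p`;
`− inv_v(B ⊗_F F[a])` otherwise `}` of `ℚ/ℤ` is killed by `m(a)/d`.»  (p. 405, p0033 L23–L27: «From now on `c` will denote a
positive rational number of the form `p^r c₀`, where `c₀` is a `p`-adic unit […]. We say that an algebraic number `a ∈ ℚ̄` is a
`c`-number if the image of `a` under any embedding `ℚ̄ → ℚ̄_p` lies in the valuation ring of `ℚ̄_p` and the image of `a` under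
any embedding `ℚ̄ → ℂ` has absolute value `c^{1/2}`.»)

(p. 437–438, p0065 L45–L54, p0066 L1–L2): «Let `c` be a positive rational number of the form `p^r c₀`, where `c₀` is a `p`-adic
unit. Suppose that `(A, λ, i)` is a `c`-polarized virtual `B`-abelian variety over `k_r` up to isogeny satisfying the three
conditions of §14. In §14 we associated to `(A, λ, i)` a triple `(γ₀; γ, δ)` satisfying the conditions of §2 of [K5]. Now let
`(γ₀; γ, δ)` be a triple satisfying the conditions of §2 in [K5].  **Lemma 18.1.** There exists a `c`-polarized virtual
`B`-abelian variety `(A, λ, i)` over `k_r` satisfying the three conditions of §14, such that the triple associated to `(A, λ, i)`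
is `(γ₀; γ, δ)`, if and only if the following three conditions hold: (1) `γ₀γ₀^* = c^{−1}`, (2) `α(γ₀; γ, δ)` is trivial,
(3) there exists a lattice `Λ` in `V_{L_r}` such that `(δσ)(Λ) ⊃ Λ`.»

(p. 439, p0067 L7–L11): «Put `π₁ = c^{−1/2} π₀`. The multiplicity of `c^{1/2}` (respectively, `−c^{1/2}`) as a root of `f` is
equal to `d` times the multiplicity of `1` (respectively, `−1`) as an eigenvalue of `π₁ ∈ Sp_{2n}(ℝ)`, and it is easy to see
that the multiplicities of `1` and `−1` as eigenvalues of any element of `Sp_{2n}(ℂ)` are both even.»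

NOT typed here: the construction of `f_A` (p. 436–437: the multiplicities `m_l(j)` are independent of `l`; `2 dim A` is
divisible by `[F : ℚ]`), which belongs with §10; the proof of Lemma 18.1 (pp. 438–440: Lemmas 3.5, 10.7, 10.8, 11.5, 11.6, 15.2,
17.1, Cor. 3.4, Prop. 2.6 of [K4], Lemma 9.2).  HC_CM is proved only modulo the printed citations until rung 0 closes; this file
discharges none of them.

## References
* [Kottwitz1992] R. E. Kottwitz, *Points on some Shimura varieties over finite fields*, J. Amer. Math. Soc. 5 (1992),
  §18 pp. 436–440 (Lemma 18.1 p. 437), §10 p. 405, Lemma 10.13 p. 409.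
* [K5] = R. E. Kottwitz, *Shimura varieties and λ-adic representations*, Perspect. Math. 10 (1990) 161–209, §2 (the conditions
  on `(γ₀; γ, δ)`, the invariant `α(γ₀; γ, δ)`) — quoted by [Kottwitz1992], not read here.
-/

open Polynomial

namespace Literature.NumberTheory.Kottwitz1992.TripleImage

universe u v

/-! ## (a) The local obstruction in `ℚ/ℤ` and the multiplicity condition (p. 437) -/

/-- **The local obstruction at a REAL place** `v` of `F[a]` (first case of the display on p. 437): `½ − inv_v(B ⊗_F F[a])`,
an element of `ℚ/ℤ` (Mathlib's `AddCircle (1 : ℚ) = ℚ ⧸ ℤ·1`); argument `inv = inv_v(B ⊗_F F[a])`.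
[cite: Kottwitz1992, §18 (p. 437)] -/
def realObstruction (inv : AddCircle (1 : ℚ)) : AddCircle (1 : ℚ) :=
  (((1 : ℚ) / 2 : ℚ) : AddCircle (1 : ℚ)) - inv

/-- **The local obstruction at a place `v ∣ p`** of `F[a]` (second case of the display on p. 437):
`[F[a]_v : ℚ_p]·v(a)/v(p^r) − inv_v(B ⊗_F F[a]) ∈ ℚ/ℤ`; arguments `inv = inv_v(B ⊗_F F[a])`, the local degree
`n = [F[a]_v : ℚ_p]` and the ratio `ρ = v(a)/v(p^r) ∈ ℚ`. [cite: Kottwitz1992, §18 (p. 437)] -/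
def padicObstruction (inv : AddCircle (1 : ℚ)) (n : ℕ) (ρ : ℚ) : AddCircle (1 : ℚ) :=
  (((n : ℚ) * ρ : ℚ) : AddCircle (1 : ℚ)) - inv

/-- **The local obstruction at any OTHER place** `v` of `F[a]` (complex, or finite prime to `p`; third case of the display on
p. 437): `− inv_v(B ⊗_F F[a]) ∈ ℚ/ℤ`. [cite: Kottwitz1992, §18 (p. 437)] -/
def otherObstruction (inv : AddCircle (1 : ℚ)) : AddCircle (1 : ℚ) :=
  -inv

/-- **The multiplicity condition at a root `a`** (p. 437): «the multiplicity `m(a)` […] is divisible by `d` and for every place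
`v` of `F[a]` the element [`realObstruction` ∕ `padicObstruction` ∕ `otherObstruction`, by the kind of `v`] of `ℚ/ℤ` is killed
by `m(a)/d`».  Arguments: `d` (`d² = dim_F B`), `m = m(a)`; the real places, the places over `p` and the remaining places of
`F[a]` as three index types, each with `v ↦ inv_v(B ⊗_F F[a])`, and for `v ∣ p` also `[F[a]_v : ℚ_p]` and `v(a)/v(p^r)`.
[cite: Kottwitz1992, §18 (p. 437)] -/
def MultiplicityCondition (d m : ℕ) {RealPlace PadicPlace OtherPlace : Type v}
    (invReal : RealPlace → AddCircle (1 : ℚ)) (invPadic : PadicPlace → AddCircle (1 : ℚ))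
    (localDegree : PadicPlace → ℕ) (ordRatio : PadicPlace → ℚ) (invOther : OtherPlace → AddCircle (1 : ℚ)) : Prop :=
  d ∣ m ∧ (∀ v : RealPlace, (m / d) • realObstruction (invReal v) = 0) ∧
    (∀ v : PadicPlace, (m / d) • padicObstruction (invPadic v) (localDegree v) (ordRatio v) = 0) ∧
      ∀ v : OtherPlace, (m / d) • otherObstruction (invOther v) = 0

/-- «`c` will denote a positive rational number of the form `p^r c₀`, where `c₀` is a `p`-adic unit» (p. 405; the standing form
of `c` in Lemma 18.1, p. 437): `0 < c` and `v_p(c) = r`. [cite: Kottwitz1992, §10 (p. 405); §18 (p. 437)] -/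
def IsAdmissibleC (p r : ℕ) (c : ℚ) : Prop :=
  0 < c ∧ padicValRat p c = r

/-! ## (b) The characteristic-polynomial criterion (p. 437) — typed skeleton -/

/-- **Carriers for the criterion of p. 437.**  `F` is the centre of the simple algebra `B` (a number field) and `K ⊇ F` an
ALGEBRAICALLY CLOSED field (`[IsAlgClosed K]`, e.g. `ℚ̄`) in which the roots `a` of `f ∈ F[T]` are taken («every root `a` of `f` in
`ℚ̄»).  Fields (with the hypotheses `p_prime`, `r_pos`, `d_pos` that make the carriers meaningful: «a positive integer `d`», p. 437):
* `p`, `r` — the residue characteristic and the degree `[k_r : 𝔽_p]`; `c` — the positive rational `p^r c₀` of §10;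
* `d` — «the positive integer `d` defined by `d² = dim_F B`»;
* `IsCNumber a` — «`a` is a `c`-number» (§10 p. 405: every embedding into `ℚ̄_p` lands in the valuation ring, every embedding
  into `ℂ` has absolute value `c^{1/2}`; typed with §10 in `VirtualAbelianVarieties.lean`, a carrier here);
* `RealPlace a`, `PadicPlace a`, `OtherPlace a` — the places `v` of the number field `F[a] ⊆ K` that are real, divide `p`,
  or neither, with `inv… a v = inv_v(B ⊗_F F[a]) ∈ ℚ/ℤ`, and for `v ∣ p` `localDegree a v = [F[a]_v : ℚ_p]`,
  `ordRatio a v = v(a)/v(p^r)`;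
* `ComesFrom f` — «`f` comes from some `A` in `𝒱_{r,c,B}`», i.e. `f = f_A` is the characteristic polynomial (p. 436–437) of a
  `B`-object `A` of the category of `c`-polarizable virtual abelian varieties over `k_r` up to isogeny with `2 dim A = [F : ℚ]·deg f`.
[cite: Kottwitz1992, §18 (pp. 436–437); §10 (p. 405)] -/
structure CharPolyDatum (F : Type u) (K : Type v) [Field F] [Field K] [Algebra F K] [IsAlgClosed K] where
  /-- the prime `p` -/
  p : ℕ
  /-- `p` is prime -/
  p_prime : p.Prime
  /-- `k_r = 𝔽_{p^r}` -/
  r : ℕ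
  /-- `r ≥ 1` -/
  r_pos : 0 < r
  /-- the positive rational `c = p^r c₀` -/
  c : ℚ
  /-- `c` is positive with `v_p(c) = r` -/
  c_adm : IsAdmissibleC p r c
  /-- `d² = dim_F B` -/
  d : ℕ
  /-- «a positive integer `d`» -/
  d_pos : 0 < d
  /-- `a ∈ K` is a `c`-number (§10) -/
  IsCNumber : K → Prop
  /-- real places of `F[a]` -/
  RealPlace : K → Type v
  /-- places of `F[a]` dividing `p` -/
  PadicPlace : K → Type v
  /-- the other places of `F[a]` (complex, finite prime to `p`) -/
  OtherPlace : K → Type v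
  /-- `inv_v(B ⊗_F F[a]) ∈ ℚ/ℤ`, `v` real -/
  invReal : (a : K) → RealPlace a → AddCircle (1 : ℚ)
  /-- `inv_v(B ⊗_F F[a]) ∈ ℚ/ℤ`, `v ∣ p` -/
  invPadic : (a : K) → PadicPlace a → AddCircle (1 : ℚ)
  /-- `[F[a]_v : ℚ_p]`, `v ∣ p` -/
  localDegree : (a : K) → PadicPlace a → ℕ
  /-- `v(a)/v(p^r)`, `v ∣ p` -/
  ordRatio : (a : K) → PadicPlace a → ℚ
  /-- `inv_v(B ⊗_F F[a]) ∈ ℚ/ℤ`, `v` another place -/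
  invOther : (a : K) → OtherPlace a → AddCircle (1 : ℚ)
  /-- `f` comes from some `A` in `𝒱_{r,c,B}` -/
  ComesFrom : F[X] → Prop

namespace CharPolyDatum

variable {F : Type u} {K : Type v} [Field F] [Field K] [Algebra F K] [IsAlgClosed K]

/-- The multiplicity `m(a)` of `a ∈ K` as a root of `f ∈ F[T]`. [cite: Kottwitz1992, §18 (p. 437)] -/
noncomputable def rootMult (_D : CharPolyDatum F K) (f : F[X]) (a : K) : ℕ :=
  (f.map (algebraMap F K)).rootMultiplicity a

/-- **The criterion of p. 437** (from Lemma 10.13, Lemma 3.5∕Cor. 3.4, Lemmas 11.5∕11.6), AS PRINTED: «`f` comes from some `A` in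
`𝒱_{r,c,B}` if and only if every root `a` of `f` in `ℚ̄` is a `c`-number and the multiplicity `m(a)` of each root `a` of `f` has
the property that it is divisible by `d` and for every place `v` of `F[a]` the element [`real`∕`padic`∕`otherObstruction`] of `ℚ/ℤ` is killed by
`m(a)/d`», for `f ∈ F[T]` monic (of the fixed degree `m`).  TYPED SKELETON: nothing is asserted.
[cite: Kottwitz1992, §18 (p. 437)] -/
def Criterion (D : CharPolyDatum F K) : Prop :=
  ∀ f : F[X], f.Monic →
    (D.ComesFrom f ↔
      ∀ a : K, (f.map (algebraMap F K)).IsRoot a →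
        D.IsCNumber a ∧
          MultiplicityCondition D.d (D.rootMult f a) (D.invReal a) (D.invPadic a) (D.localDegree a) (D.ordRatio a)
            (D.invOther a))

end CharPolyDatum

/-! ## (c) Lemma 18.1 — typed skeleton -/

/-- **Carriers for Lemma 18.1** (§14, §17, §18 and [K5] §2).  Fields:
* `p`, `r` — as above (`k_r = 𝔽_{p^r}`, `L_r = Frac W(k_r)`, `σ` its Frobenius), with `p_prime`, `r_pos`;
* `Triple` — the triples `(γ₀; γ, δ)` «satisfying the conditions of §2 in [K5]» (`γ₀ ∈ G(ℚ)` semisimple and elliptic in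
  `G(ℝ)`, `γ ∈ G(𝔸_f^p)`, `δ ∈ G(L_r)`), taken UP TO EQUIVALENCE (Lemma 17.2, p. 435: «`γ₀, γ₀'` are stably conjugate; `γ, γ'`
  are conjugate; `δ, δ'` are `σ`-conjugate») — the associated triple of §14 is only defined up to these choices (p. 419, p. 422);
* `simil t ∈ ℚ^×` — the image of `γ₀` under «the usual homomorphism `G → 𝔾_m`» (p. 422), i.e. `γ₀γ₀^*`;
* `AlphaTrivial t` — «`α(γ₀; γ, δ)` is trivial» (the invariant of [K5] §2 in `X^*(Z(Î₀)^Γ)`, §§14–15);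
* `Lat` — lattices `Λ` in `V_{L_r} = V ⊗_ℚ L_r`, `LE Λ Λ'` — `Λ ⊆ Λ'`, `deltaSigma t Λ = (δσ)(Λ)`;
* `PolAV c` — for a rational `c`, the isogeny classes of `c`-polarized virtual `B`-abelian varieties `(A, λ, i)` over `k_r` up to
  isogeny «satisfying the three conditions of §14» (p. 418–419); `tripleOf A` — «the triple associated to `(A, λ, i)`» (§14).
[cite: Kottwitz1992, §18 Lemma 18.1 (p. 437); §14 (pp. 418–422); §17 Lemma 17.2 (p. 435)] -/
structure TripleImageDatum where
  /-- the prime `p` -/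
  p : ℕ
  /-- `p` is prime -/
  p_prime : p.Prime
  /-- `k_r = 𝔽_{p^r}` -/
  r : ℕ
  /-- `r ≥ 1` -/
  r_pos : 0 < r
  /-- equivalence classes of triples `(γ₀; γ, δ)` satisfying the conditions of [K5] §2 -/
  Triple : Type u
  /-- `γ₀γ₀^* ∈ ℚ^×` -/
  simil : Triple → ℚ
  /-- `α(γ₀; γ, δ) = 1` -/
  AlphaTrivial : Triple → Prop
  /-- lattices in `V ⊗ L_r` -/
  Lat : Type u
  /-- inclusion of lattices -/
  LE : Lat → Lat → Prop
  /-- `Λ ↦ (δσ)(Λ)` -/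
  deltaSigma : Triple → Lat → Lat
  /-- isogeny classes of `c`-polarized virtual `B`-abelian varieties over `k_r` satisfying the three conditions of §14 -/
  PolAV : ℚ → Type u
  /-- the §14 map `(A, λ, i) ↦ (γ₀; γ, δ)` -/
  tripleOf : {c : ℚ} → PolAV c → Triple

namespace TripleImageDatum

/-- Condition (3) of Lemma 18.1: «there exists a lattice `Λ` in `V_{L_r}` such that `(δσ)(Λ) ⊃ Λ`».
[cite: Kottwitz1992, §18 Lemma 18.1 (3) (p. 438)] -/
def HasDeltaSigmaStableLattice (D : TripleImageDatum.{u}) (t : D.Triple) : Prop :=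
  ∃ Λ : D.Lat, D.LE Λ (D.deltaSigma t Λ)

/-- **[Kottwitz1992, Lemma 18.1]** (pp. 437–438), AS PRINTED: «Let `c` be a positive rational number of the form `p^r c₀`, where
`c₀` is a `p`-adic unit. […] Now let `(γ₀; γ, δ)` be a triple satisfying the conditions of §2 in [K5]. Lemma 18.1. There exists a
`c`-polarized virtual `B`-abelian variety `(A, λ, i)` over `k_r` satisfying the three conditions of §14, such that the triple
associated to `(A, λ, i)` is `(γ₀; γ, δ)`, if and only if the following three conditions hold: (1) `γ₀γ₀^* = c^{−1}`,
(2) `α(γ₀; γ, δ)` is trivial, (3) there exists a lattice `Λ` in `V_{L_r}` such that `(δσ)(Λ) ⊃ Λ`.»  TYPED SKELETON over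
`TripleImageDatum`: nothing is asserted. [cite: Kottwitz1992, Lemma 18.1 (p. 437)] -/
def Lemma18_1 (D : TripleImageDatum.{u}) : Prop :=
  ∀ c : ℚ, IsAdmissibleC D.p D.r c →
    ∀ t : D.Triple,
      (∃ A : D.PolAV c, D.tripleOf A = t) ↔
        (D.simil t = c⁻¹ ∧ D.AlphaTrivial t ∧ D.HasDeltaSigmaStableLattice t)

/-- The forward half of Lemma 18.1 as the paper proves it first (p. 438, p0066 L4–L9: «if `(γ₀; γ, δ)` comes from `(A, λ, i)`, then
it satisfies (1), (2), and (3). In fact, (1) is obvious and Lemma 15.1 asserts that (2) holds […] (3) holds as well»): the triple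
associated to any `(A, λ, i)` satisfies (1)–(3). TYPED SKELETON. [cite: Kottwitz1992, §18, proof of Lemma 18.1 (p. 438)] -/
def Lemma18_1_necessity (D : TripleImageDatum.{u}) : Prop :=
  ∀ c : ℚ, IsAdmissibleC D.p D.r c → ∀ A : D.PolAV c,
    D.simil (D.tripleOf A) = c⁻¹ ∧ D.AlphaTrivial (D.tripleOf A) ∧ D.HasDeltaSigmaStableLattice (D.tripleOf A)

end TripleImageDatum

/-! ## (d) Eigenvalues `±1` of symplectic matrices (p. 439) — already in the tree

«It is easy to see that the multiplicities of `1` and `−1` as eigenvalues of any element of `Sp_{2n}(ℂ)` are both even» (p. 439, used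
for the real places in Case C) is a THEOREM of the tree, for every field with `2 ≠ 0` and multiplicity read as a root multiplicity of
the characteristic polynomial: `Literature.LinearAlgebra.Matrix.SymplecticCharpoly.even_rootMultiplicity_one_of_mem` and
`Literature.LinearAlgebra.Matrix.SymplecticCharpoly.even_rootMultiplicity_neg_one_of_mem`
(`Literature/LinearAlgebra/Matrix/SymplecticCharpolyReciprocal.lean`, over Mathlib's `Matrix.symplecticGroup l K`).  Cited, not
restated. -/

end Literature.NumberTheory.Kottwitz1992.TripleImage
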